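import Literature.Analysis.Calculus.BoxStokes
import Mathlib.Algebra.Module.ZLattice.Basic
import Mathlib.MeasureTheory.Group.FundamentalDomain
import Mathlib.MeasureTheory.Measure.Lebesgue.Basic
import Mathlib.MeasureTheory.Constructions.Pi
import Mathlib.MeasureTheory.Integral.Prod
import Mathlib.LinearAlgebra.Determinant
import Mathlib.Topology.Algebra.Module.FiniteDimension
import HarnessLib

/-!
# Stokes' theorem on the unit box for forms whose faces are paired by unimodular affine maps:
# `∫_{[0,1]^{m+1}} dη(e₀, …, e_m) = 0`, and the torus lemma `∫_{[0,1]^ι} φ(gx + c) dx = ∫_{[0,1]^ι} φ`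

The classical fact behind "the integral of an exact top form over a closed manifold vanishes" (Stokes'
theorem for the singular cube, [cite: Spivak1965, Thm. 4-13], summed over a cube whose faces are identified), in
the concrete form needed for tori and torus bundles over tori presented as quotients of `ℝ^{m+1}` by a group of
affine maps: if a `C¹` `m`-form `η` on a neighbourhood of the unit box `[0,1]^{m+1} ⊆ ℝ^{m+1}` has, for every
coordinate direction `i`, its back face `{x_i = 0}` carried onto its front face `{x_i = 1}` by an affine map
`h(w) = Lw + d` with `η = h^*η`, `h` acting on the face as a map `G` under which the front-face integrand keeps
its integral (a translation, or an affine map unimodular and lattice-preserving on a block of coordinates in which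
`η` is `ℤ`-periodic), then the face integrals of the tree's `integral_extDeriv_Icc_eq_sum_faces`
(`Literature/Analysis/Calculus/BoxStokes.lean`, Stokes on a box) cancel in pairs and
**`∫_{[0,1]^{m+1}} dη(e₀, …, e_m) = 0`** (`integral_extDeriv_unitCube_eq_zero`).

The cancellation of a sheared pair of faces rests on two facts proved here:

* §1 **the torus lemma** (`setIntegral_unitCube_comp_affine_eq`): for a `ℤ^κ`-periodic `φ : ℝ^κ → F`, a linear
  automorphism `g` of `ℝ^κ` with `g(ℤ^κ) = ℤ^κ` and `|det g| = 1`, and any `c ∈ ℝ^κ`,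
  `∫_{[0,1]^κ} φ(gx + c) dx = ∫_{[0,1]^κ} φ(x) dx` — the change of variables formula
  [cite: Spivak1965, Thm. 3-13] together with the fact that `g([0,1)^κ) + c` is again a fundamental domain of
  `ℤ^κ` (Mathlib's `ZSpan.isAddFundamentalDomain`, `IsAddFundamentalDomain.image_of_equiv`,
  `IsAddFundamentalDomain.setIntegral_eq`, `Real.map_linearMap_volume_pi_eq_smul_volume_pi`); and its block form
  `setIntegral_unitCube_comp_blockAffine_eq` (`g` acting on the coordinates of a block `p`, the identity on the
  other coordinates; Fubini through Mathlib's `volume_preserving_piEquivPiSubtypeProd`);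
* §2 **top-degree alternating maps scale by the determinant**: `f(g ∘ v) = det g • f(v)` for an `N`-valued
  alternating map `f` in `dim` arguments (`alternatingMap_apply_linearMap_comp_eq_det_smul`, from Mathlib's
  `Basis.ext_alternating` and `Basis.det_comp`) [cite: Spivak1965, Thm. 4-6];

then §3 gives the face identities (`apply_insertNth_zero_eq_apply_insertNth_one_of_invariant`: the back-face
integrand is the front-face integrand composed with `G`; the translation case
`apply_insertNth_zero_eq_apply_insertNth_one_of_periodic`) and §4 the vanishing of `∫ dη(e₀,…,e_m)`.
Theorems only (no definitions, no named facts; net debt 0). Used by the cohomology of the cusp stabilizer of a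
Hilbert modular group (Freitag 1990, Ch. III §2 Prop. 2.1: the compact quotient `{Ny = 1}/Γ_∞` is such a torus
bundle over a torus).

## References
* [Spivak1965] M. Spivak, *Calculus on Manifolds*, Benjamin 1965, Thm. 3-13 (change of variables), Thm. 4-6
  (`ω(Tv₁, …, Tv_n) = det T · ω(v₁, …, v_n)` for top forms), Thm. 4-13 (Stokes' theorem for chains) and the
  boundary of the standard cube before it.
* [Freitag1990] E. Freitag, *Hilbert modular forms*, Springer 1990, Ch. III §2, proof of Prop. 2.1, p. 144
  («The quotient `D/Γ_∞` is compact!»).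
-/

noncomputable section

open Set MeasureTheory Module

namespace Literature.Analysis.Calculus

/-! ## §1 The torus lemma -/

section Torus

variable {κ : Type*} [Fintype κ] {F' : Type*} [NormedAddCommGroup F'] [NormedSpace ℝ F']

/-- Membership in `ℤ^κ = span_ℤ(e_j) ⊆ ℝ^κ` is integrality of all coordinates. [folklore] -/
private theorem mem_zspan_basisFun_iff (x : κ → ℝ) :
    x ∈ Submodule.span ℤ (Set.range (Pi.basisFun ℝ κ)) ↔ ∀ j, ∃ n : ℤ, x j = n := by
  rw [Basis.mem_span_iff_repr_mem ℤ (Pi.basisFun ℝ κ) x]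
  refine forall_congr' fun j ↦ ?_
  rw [Pi.basisFun_repr]
  constructor
  · rintro ⟨n, hn⟩
    exact ⟨n, by rw [← hn]; rfl⟩
  · rintro ⟨n, hn⟩
    exact ⟨n, by rw [hn]; rfl⟩

omit [NormedAddCommGroup F'] [NormedSpace ℝ F'] in
/-- A function periodic under the coordinate unit translations is periodic under `ℤ^κ`. [folklore] -/
private theorem periodic_of_forall_single [DecidableEq κ] {φ : (κ → ℝ) → F'} (hper : ∀ j x, φ (x + Pi.single j 1) = φ x)
    {ℓ : κ → ℝ} (hℓ : ℓ ∈ Submodule.span ℤ (Set.range (Pi.basisFun ℝ κ))) (x : κ → ℝ) : φ (x + ℓ) = φ x := by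
  induction hℓ using Submodule.span_induction generalizing x with
  | mem v hv =>
    obtain ⟨j, rfl⟩ := hv
    rw [Pi.basisFun_apply]
    exact hper j x
  | zero => rw [add_zero]
  | add u v _ _ hu hv => rw [← add_assoc, hv, hu]
  | smul a v _ hv =>
    have key : ∀ (b : ℤ) (x : κ → ℝ), φ (x + b • v) = φ x := fun b ↦
      Int.induction_on b (fun x ↦ by rw [zero_smul, add_zero])
        (fun n ih x ↦ by rw [add_smul, one_smul, ← add_assoc, hv, ih])
        (fun n ih x ↦ by
          have h := hv (x + (-(n : ℤ) - 1) • v)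
          rw [show x + (-(n : ℤ) - 1) • v + v = x + (-(n : ℤ)) • v by rw [sub_smul, one_smul]; abel] at h
          rw [← h, ih])
    exact key a x

/-- An affine map `x ↦ gx + c` of `ℝ^κ` with `|det g| = 1` preserves Lebesgue measure.
[cite: Spivak1965, Thm. 3-13] -/
theorem measurePreserving_affine_of_abs_det_eq_one [DecidableEq κ] (g : (κ → ℝ) ≃ₗ[ℝ] (κ → ℝ))
    (hdet : |LinearMap.det (g : (κ → ℝ) →ₗ[ℝ] (κ → ℝ))| = 1) (c : κ → ℝ) :
    MeasurePreserving (fun x ↦ g x + c) := by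
  have hne : LinearMap.det (g : (κ → ℝ) →ₗ[ℝ] (κ → ℝ)) ≠ 0 := by
    intro h
    rw [h, abs_zero] at hdet
    exact zero_ne_one hdet
  have h1 : MeasurePreserving (g : (κ → ℝ) → (κ → ℝ)) volume volume := by
    refine ⟨(g : (κ → ℝ) →ₗ[ℝ] (κ → ℝ)).continuous_of_finiteDimensional.measurable, ?_⟩
    have h := Real.map_linearMap_volume_pi_eq_smul_volume_pi hne
    rw [abs_inv, hdet, inv_one, ENNReal.ofReal_one, one_smul] at h
    exact h
  exact (measurePreserving_add_right volume c).comp h1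

/-- **The torus lemma.** For a `ℤ^κ`-periodic `φ : ℝ^κ → F`, a linear automorphism `g` of `ℝ^κ` mapping the
lattice `ℤ^κ` onto itself with `|det g| = 1`, and `c ∈ ℝ^κ`: `∫_{[0,1]^κ} φ(gx + c) dx = ∫_{[0,1]^κ} φ(x) dx`
(the image `g([0,1)^κ) + c` of the fundamental parallelotope is again a fundamental domain of `ℤ^κ`, and
`x ↦ gx + c` preserves the measure). No integrability hypothesis is needed. [cite: Spivak1965, Thm. 3-13] -/
theorem setIntegral_unitCube_comp_affine_eq [DecidableEq κ] (φ : (κ → ℝ) → F') (hper : ∀ j x, φ (x + Pi.single j 1) = φ x)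
    (g : (κ → ℝ) ≃ₗ[ℝ] (κ → ℝ))
    (hg : ∀ x ∈ Submodule.span ℤ (Set.range (Pi.basisFun ℝ κ)),
      g x ∈ Submodule.span ℤ (Set.range (Pi.basisFun ℝ κ)))
    (hg' : ∀ x ∈ Submodule.span ℤ (Set.range (Pi.basisFun ℝ κ)),
      g.symm x ∈ Submodule.span ℤ (Set.range (Pi.basisFun ℝ κ)))
    (hdet : |LinearMap.det (g : (κ → ℝ) →ₗ[ℝ] (κ → ℝ))| = 1) (c : κ → ℝ) :
    ∫ x in Icc (0 : κ → ℝ) 1, φ (g x + c) = ∫ x in Icc (0 : κ → ℝ) 1, φ x := by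
  set Λ : Submodule ℤ (κ → ℝ) := Submodule.span ℤ (Set.range (Pi.basisFun ℝ κ)) with hΛ
  set P : Set (κ → ℝ) := ZSpan.fundamentalDomain (Pi.basisFun ℝ κ) with hP
  -- `P = [0,1)^κ` differs from `[0,1]^κ` by a null set
  have hae : (P : Set (κ → ℝ)) =ᵐ[volume] Icc (0 : κ → ℝ) 1 := by
    rw [hP, ZSpan.fundamentalDomain_pi_basisFun]
    exact Measure.univ_pi_Ico_ae_eq_Icc
  -- the affine map as a measurable equivalence
  set T : (κ → ℝ) ≃ₜ (κ → ℝ) := g.toContinuousLinearEquiv.toHomeomorph.trans (Homeomorph.addRight c) with hT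
  have hTapply : ∀ x, T x = g x + c := fun x ↦ rfl
  have hTm : MeasurePreserving (⇑T.toMeasurableEquiv) volume volume :=
    measurePreserving_affine_of_abs_det_eq_one g hdet c
  -- the lattice `ℤ^κ` acting by translations
  haveI : MeasurableVAdd Λ (κ → ℝ) := (inferInstance : MeasurableVAdd Λ.toAddSubgroup (κ → ℝ))
  haveI : VAddInvariantMeasure Λ (κ → ℝ) volume :=
    (inferInstance : VAddInvariantMeasure Λ.toAddSubgroup (κ → ℝ) volume)
  have hD : IsAddFundamentalDomain Λ P volume := ZSpan.isAddFundamentalDomain (Pi.basisFun ℝ κ) volume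
  -- the lattice automorphism `ℓ ↦ g⁻¹ℓ` intertwines `T` with the translations
  set e : Λ ≃ Λ :=
    { toFun := fun ℓ ↦ ⟨g.symm ℓ, hg' ℓ ℓ.2⟩
      invFun := fun ℓ ↦ ⟨g ℓ, hg ℓ ℓ.2⟩
      left_inv := fun ℓ ↦ Subtype.ext (g.apply_symm_apply (ℓ : κ → ℝ))
      right_inv := fun ℓ ↦ Subtype.ext (g.symm_apply_apply (ℓ : κ → ℝ)) } with he
  have heapply : ∀ ℓ : Λ, ((e ℓ : Λ) : κ → ℝ) = g.symm ℓ := fun _ ↦ rfl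
  have hD' : IsAddFundamentalDomain Λ (⇑T.toMeasurableEquiv '' P) volume := by
    refine hD.image_of_equiv T.toMeasurableEquiv.toEquiv ?_ e fun ℓ x ↦ ?_
    · exact (MeasurePreserving.symm _ hTm).quasiMeasurePreserving
    · change T ((e ℓ : Λ) +ᵥ x) = ℓ +ᵥ T x
      rw [Submodule.vadd_def, Submodule.vadd_def, vadd_eq_add, vadd_eq_add, hTapply, hTapply, heapply, map_add,
        LinearEquiv.apply_symm_apply, add_assoc]
  have hperΛ : ∀ (ℓ : Λ) (x : κ → ℝ), φ (ℓ +ᵥ x) = φ x := fun ℓ x ↦ by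
    rw [Submodule.vadd_def, vadd_eq_add, add_comm]
    exact periodic_of_forall_single hper ℓ.2 x
  have h1 : ∫ x in P, φ (T x) = ∫ y in ⇑T.toMeasurableEquiv '' P, φ y :=
    (hTm.setIntegral_image_emb T.toMeasurableEquiv.measurableEmbedding φ P).symm
  have h2 : ∫ y in ⇑T.toMeasurableEquiv '' P, φ y = ∫ y in P, φ y := hD'.setIntegral_eq hD hperΛ
  calc ∫ x in Icc (0 : κ → ℝ) 1, φ (g x + c) = ∫ x in P, φ (g x + c) := (setIntegral_congr_set hae).symm
    _ = ∫ y in P, φ y := h1.trans h2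
    _ = ∫ x in Icc (0 : κ → ℝ) 1, φ x := setIntegral_congr_set hae

/-- Splitting the coordinates into a block `p` and its complement carries the unit cube to the product of the unit
cubes. [folklore] -/
private theorem preimage_piEquivPiSubtypeProd_Icc {ι : Type*} [Fintype ι] (p : ι → Prop) [DecidablePred p] :
    ⇑(MeasurableEquiv.piEquivPiSubtypeProd (fun _ : ι ↦ ℝ) p) ⁻¹'
        (Icc (0 : {i // p i} → ℝ) 1 ×ˢ Icc (0 : {i // ¬p i} → ℝ) 1) = Icc (0 : ι → ℝ) 1 := by
  ext x
  simp only [Set.mem_preimage, Set.mem_prod, Set.mem_Icc, Pi.le_def, Pi.zero_apply, Pi.one_apply,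
    MeasurableEquiv.piEquivPiSubtypeProd_apply, Subtype.forall]
  constructor
  · rintro ⟨⟨h1, h2⟩, ⟨h3, h4⟩⟩
    refine ⟨fun i ↦ ?_, fun i ↦ ?_⟩
    · by_cases hi : p i
      · exact h1 i hi
      · exact h3 i hi
    · by_cases hi : p i
      · exact h2 i hi
      · exact h4 i hi
  · rintro ⟨h1, h2⟩
    exact ⟨⟨fun i _ ↦ h1 i, fun i _ ↦ h2 i⟩, ⟨fun i _ ↦ h1 i, fun i _ ↦ h2 i⟩⟩

/-- Translating the block coordinates by a unit vector of the block is translating by the corresponding unit vector.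
[folklore] -/
private theorem piEquivPiSubtypeProd_symm_add_single {ι : Type*} [Fintype ι] [DecidableEq ι] (p : ι → Prop)
    [DecidablePred p] (a : {i // p i} → ℝ) (b : {i // ¬p i} → ℝ) (j : {i // p i}) :
    (MeasurableEquiv.piEquivPiSubtypeProd (fun _ : ι ↦ ℝ) p).symm (a + Pi.single j 1, b) =
      (MeasurableEquiv.piEquivPiSubtypeProd (fun _ : ι ↦ ℝ) p).symm (a, b) + Pi.single (j : ι) 1 := by
  ext i
  simp only [MeasurableEquiv.piEquivPiSubtypeProd_symm_apply, Pi.add_apply]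
  by_cases hi : p i
  · rw [dif_pos hi, dif_pos hi, Pi.single_apply, Pi.single_apply]
    have : ((⟨i, hi⟩ : {i // p i}) = j) ↔ (i = (j : ι)) := by
      rw [Subtype.ext_iff]
    simp only [this]
  · rw [dif_neg hi, dif_neg hi]
    have hij : i ≠ (j : ι) := fun h ↦ hi (h ▸ j.2)
    rw [Pi.single_eq_of_ne hij, add_zero]

/-- **The torus lemma, block form.** Let `p` single out a block of coordinates of `ℝ^ι` (identified with `κ₀`
through `ρ`), `g` a linear automorphism of `ℝ^{κ₀}` mapping `ℤ^{κ₀}` onto itself with `|det g| = 1`, `c ∈ ℝ^{κ₀}`,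
and `G` the map of `ℝ^ι` acting as `x ↦ gx + c` on the block and as the identity on the other coordinates. For a
continuous `φ : ℝ^ι → F` that is `ℤ`-periodic in the coordinates of the block,
`∫_{[0,1]^ι} φ(G x) dx = ∫_{[0,1]^ι} φ(x) dx` (Fubini and the torus lemma in the block).
[cite: Spivak1965, Thm. 3-13] -/
theorem setIntegral_unitCube_comp_blockAffine_eq {ι : Type*} [Fintype ι] [DecidableEq ι] (p : ι → Prop)
    [DecidablePred p] {κ₀ : Type*} [Fintype κ₀] [DecidableEq κ₀] (ρ : {i // p i} ≃ κ₀)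
    (g : (κ₀ → ℝ) ≃ₗ[ℝ] (κ₀ → ℝ))
    (hg : ∀ x ∈ Submodule.span ℤ (Set.range (Pi.basisFun ℝ κ₀)),
      g x ∈ Submodule.span ℤ (Set.range (Pi.basisFun ℝ κ₀)))
    (hg' : ∀ x ∈ Submodule.span ℤ (Set.range (Pi.basisFun ℝ κ₀)),
      g.symm x ∈ Submodule.span ℤ (Set.range (Pi.basisFun ℝ κ₀)))
    (hdet : |LinearMap.det (g : (κ₀ → ℝ) →ₗ[ℝ] (κ₀ → ℝ))| = 1) (c : κ₀ → ℝ)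
    (φ : (ι → ℝ) → F') (hφ : Continuous φ) (hper : ∀ i, p i → ∀ x, φ (x + Pi.single i 1) = φ x) :
    ∫ x in Icc (0 : ι → ℝ) 1,
        φ ((MeasurableEquiv.piEquivPiSubtypeProd (fun _ : ι ↦ ℝ) p).symm
          (fun j ↦ (g (fun j' ↦ x (ρ.symm j')) + c) (ρ j), fun j ↦ x j)) =
      ∫ x in Icc (0 : ι → ℝ) 1, φ x := by
  set e := MeasurableEquiv.piEquivPiSubtypeProd (fun _ : ι ↦ ℝ) p with he_def
  have he : MeasurePreserving (⇑e) volume volume := volume_preserving_piEquivPiSubtypeProd (fun _ : ι ↦ ℝ) p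
  -- the `ρ`-conjugate of `g` on the block coordinates
  set Lρ : (κ₀ → ℝ) ≃ₗ[ℝ] ({i // p i} → ℝ) := LinearEquiv.funCongrLeft ℝ ℝ ρ with hLρ
  set g' : ({i // p i} → ℝ) ≃ₗ[ℝ] ({i // p i} → ℝ) := (Lρ.symm.trans g).trans Lρ with hg'_def
  have hg'apply : ∀ a : {i // p i} → ℝ, g' a = fun j ↦ g (fun j' ↦ a (ρ.symm j')) (ρ j) := fun a ↦ rfl
  have hg'symm : ∀ a : {i // p i} → ℝ, g'.symm a = fun j ↦ g.symm (fun j' ↦ a (ρ.symm j')) (ρ j) :=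
    fun a ↦ rfl
  set c' : {i // p i} → ℝ := fun j ↦ c (ρ j) with hc'
  -- integrality is preserved by `ρ`-reindexing
  have hint : ∀ a : {i // p i} → ℝ, a ∈ Submodule.span ℤ (Set.range (Pi.basisFun ℝ {i // p i})) →
      (fun j' ↦ a (ρ.symm j')) ∈ Submodule.span ℤ (Set.range (Pi.basisFun ℝ κ₀)) := fun a ha ↦ by
    rw [mem_zspan_basisFun_iff] at ha ⊢
    exact fun j' ↦ ha (ρ.symm j')
  have hint' : ∀ a : κ₀ → ℝ, a ∈ Submodule.span ℤ (Set.range (Pi.basisFun ℝ κ₀)) →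
      (fun j ↦ a (ρ j)) ∈ Submodule.span ℤ (Set.range (Pi.basisFun ℝ {i // p i})) := fun a ha ↦ by
    rw [mem_zspan_basisFun_iff] at ha ⊢
    exact fun j ↦ ha (ρ j)
  have hg₁ : ∀ x ∈ Submodule.span ℤ (Set.range (Pi.basisFun ℝ {i // p i})),
      g' x ∈ Submodule.span ℤ (Set.range (Pi.basisFun ℝ {i // p i})) := fun x hx ↦ by
    rw [hg'apply]
    exact hint' _ (hg _ (hint x hx))
  have hg₂ : ∀ x ∈ Submodule.span ℤ (Set.range (Pi.basisFun ℝ {i // p i})),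
      g'.symm x ∈ Submodule.span ℤ (Set.range (Pi.basisFun ℝ {i // p i})) := fun x hx ↦ by
    rw [hg'symm]
    exact hint' _ (hg' _ (hint x hx))
  have hdet' : |LinearMap.det (g' : ({i // p i} → ℝ) →ₗ[ℝ] ({i // p i} → ℝ))| = 1 := by
    have : (g' : ({i // p i} → ℝ) →ₗ[ℝ] ({i // p i} → ℝ)) =
        (Lρ : (κ₀ → ℝ) →ₗ[ℝ] ({i // p i} → ℝ)) ∘ₗ (g : (κ₀ → ℝ) →ₗ[ℝ] (κ₀ → ℝ)) ∘ₗ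
          (Lρ.symm : ({i // p i} → ℝ) →ₗ[ℝ] (κ₀ → ℝ)) :=
      LinearMap.ext fun _ ↦ rfl
    rw [this, LinearMap.det_conj]
    exact hdet
  -- the block affine map in split coordinates
  have hG : ∀ (a : {i // p i} → ℝ) (b : {i // ¬p i} → ℝ),
      e.symm (fun j ↦ (g (fun j' ↦ e.symm (a, b) (ρ.symm j')) + c) (ρ j), fun j ↦ e.symm (a, b) j) =
        e.symm (g' a + c', b) := fun a b ↦ by
    have ha : (fun j' ↦ e.symm (a, b) ((ρ.symm j' : {i // p i}) : ι)) = fun j' ↦ a (ρ.symm j') := by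
      funext j'
      simp only [he_def, MeasurableEquiv.piEquivPiSubtypeProd_symm_apply]
      rw [dif_pos (ρ.symm j').2]
    have hb : (fun j : {i // ¬p i} ↦ e.symm (a, b) (j : ι)) = b := by
      funext j
      simp only [he_def, MeasurableEquiv.piEquivPiSubtypeProd_symm_apply]
      rw [dif_neg j.2]
    rw [ha, hb, hg'apply]
    rfl
  -- continuity of the two integrands in split coordinates
  have hesymm : Continuous (fun z : ({i // p i} → ℝ) × ({i // ¬p i} → ℝ) ↦ e.symm z) := by
    refine continuous_pi fun i ↦ ?_
    by_cases hi : p i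
    · have : (fun z : ({i // p i} → ℝ) × ({i // ¬p i} → ℝ) ↦ e.symm z i) = fun z ↦ z.1 ⟨i, hi⟩ := by
        funext z
        simp only [he_def, MeasurableEquiv.piEquivPiSubtypeProd_symm_apply]
        rw [dif_pos hi]
      rw [this]
      exact (continuous_apply _).comp continuous_fst
    · have : (fun z : ({i // p i} → ℝ) × ({i // ¬p i} → ℝ) ↦ e.symm z i) = fun z ↦ z.2 ⟨i, hi⟩ := by
        funext z
        simp only [he_def, MeasurableEquiv.piEquivPiSubtypeProd_symm_apply]
        rw [dif_neg hi]
      rw [this]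
      exact (continuous_apply _).comp continuous_snd
  have haff : Continuous (fun a : {i // p i} → ℝ ↦ g' a + c') :=
    (g'.toContinuousLinearEquiv.continuous).add continuous_const
  have hF₂ : Continuous (fun z : ({i // p i} → ℝ) × ({i // ¬p i} → ℝ) ↦ φ (e.symm z)) := hφ.comp hesymm
  have hF₁ : Continuous (fun z : ({i // p i} → ℝ) × ({i // ¬p i} → ℝ) ↦ φ (e.symm (g' z.1 + c', z.2))) :=
    hφ.comp (hesymm.comp ((haff.comp continuous_fst).prodMk continuous_snd))
  -- transport of both integrals to split coordinates
  have htr : ∀ Φ : (ι → ℝ) → F', ∫ x in Icc (0 : ι → ℝ) 1, Φ x =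
      ∫ z in Icc (0 : {i // p i} → ℝ) 1 ×ˢ Icc (0 : {i // ¬p i} → ℝ) 1, Φ (e.symm z) := fun Φ ↦ by
    have h := he.setIntegral_preimage_emb e.measurableEmbedding (fun z ↦ Φ (e.symm z))
      (Icc (0 : {i // p i} → ℝ) 1 ×ˢ Icc (0 : {i // ¬p i} → ℝ) 1)
    rw [he_def, preimage_piEquivPiSubtypeProd_Icc] at h
    simp only [MeasurableEquiv.symm_apply_apply] at h
    rw [← he_def] at h
    exact h
  -- the periodic fibre integral
  set ψ : ({i // p i} → ℝ) → F' := fun a ↦ ∫ b in Icc (0 : {i // ¬p i} → ℝ) 1, φ (e.symm (a, b)) with hψ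
  have hψper : ∀ (j : {i // p i}) (a : {i // p i} → ℝ), ψ (a + Pi.single j 1) = ψ a := fun j a ↦ by
    simp only [hψ]
    refine setIntegral_congr_fun measurableSet_Icc fun b _ ↦ ?_
    rw [he_def, piEquivPiSubtypeProd_symm_add_single p a b j]
    exact hper j j.2 _
  have hG' : ∀ z : ({i // p i} → ℝ) × ({i // ¬p i} → ℝ),
      e.symm (fun j ↦ (g (fun j' ↦ e.symm z (ρ.symm j')) + c) (ρ j), fun j ↦ e.symm z j) =
        e.symm (g' z.1 + c', z.2) := fun z ↦ hG z.1 z.2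
  have hI₁ : IntegrableOn (fun z : ({i // p i} → ℝ) × ({i // ¬p i} → ℝ) ↦ φ (e.symm (g' z.1 + c', z.2)))
      (Icc (0 : {i // p i} → ℝ) 1 ×ˢ Icc (0 : {i // ¬p i} → ℝ) 1) (volume.prod volume) := by
    rw [← Measure.volume_eq_prod]
    exact hF₁.continuousOn.integrableOn_compact (isCompact_Icc.prod isCompact_Icc)
  have hI₂ : IntegrableOn (fun z : ({i // p i} → ℝ) × ({i // ¬p i} → ℝ) ↦ φ (e.symm z))
      (Icc (0 : {i // p i} → ℝ) 1 ×ˢ Icc (0 : {i // ¬p i} → ℝ) 1) (volume.prod volume) := by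
    rw [← Measure.volume_eq_prod]
    exact hF₂.continuousOn.integrableOn_compact (isCompact_Icc.prod isCompact_Icc)
  rw [htr, htr]
  simp_rw [hG']
  rw [Measure.volume_eq_prod, setIntegral_prod _ hI₁, setIntegral_prod _ hI₂]
  change ∫ a in Icc (0 : {i // p i} → ℝ) 1, ψ (g' a + c') = ∫ a in Icc (0 : {i // p i} → ℝ) 1, ψ a
  exact setIntegral_unitCube_comp_affine_eq ψ hψper g' hg₁ hg₂ hdet' c'

end Torus

/-! ## §2 Top-degree alternating maps scale by the determinant -/

section Det

/-- **`f(g v₁, …, g v_n) = det g · f(v₁, …, v_n)`** for an alternating map `f` in `n = dim` arguments with values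
in any module: an `N`-valued alternating `ι`-form on a module with basis indexed by `ι` is `v ↦ det_b(v) • f(b)`
(Mathlib's `Basis.ext_alternating`), and `det_b(g ∘ v) = det g · det_b(v)` (`Basis.det_comp`).
[cite: Spivak1965, Thm. 4-6] -/
theorem alternatingMap_apply_linearMap_comp_eq_det_smul {R : Type*} [CommRing R] {M N : Type*} [AddCommGroup M]
    [Module R M] [AddCommGroup N] [Module R N] {ι : Type*} [Fintype ι] [DecidableEq ι] (b : Basis ι R M)
    (f : M [⋀^ι]→ₗ[R] N) (g : M →ₗ[R] M) (v : ι → M) :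
    f (g ∘ v) = LinearMap.det g • f v := by
  have hfg : f = (LinearMap.toSpanSingleton R N (f b)).compAlternatingMap b.det := by
    refine Basis.ext_alternating b fun u hu ↦ ?_
    let σ : Equiv.Perm ι := Equiv.ofBijective u (Finite.injective_iff_bijective.1 hu)
    change f (b ∘ σ) = ((LinearMap.toSpanSingleton R N (f b)).compAlternatingMap b.det) (b ∘ σ)
    rw [LinearMap.compAlternatingMap_apply, LinearMap.toSpanSingleton_apply, AlternatingMap.map_perm,
      AlternatingMap.map_perm, Basis.det_self, Units.smul_def, Units.smul_def, zsmul_eq_mul, mul_one,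
      Int.cast_smul_eq_zsmul]
  have key : ∀ w : ι → M, f w = b.det w • f b := fun w ↦ by
    conv_lhs => rw [hfg]
    rw [LinearMap.compAlternatingMap_apply, LinearMap.toSpanSingleton_apply]
  rw [key (g ∘ v), key v, Basis.det_comp, mul_smul]

end Det

/-! ## §3 The face identities -/

section Faces

variable {F' : Type*} [NormedAddCommGroup F'] [NormedSpace ℝ F'] {m : ℕ}

/-- Inserting a `0` at place `i` into the unit vector `e_j` of `ℝ^m` gives the unit vector `e_{succAbove i j}` of
`ℝ^{m+1}` — the face parametrisation of Stokes' theorem on a box carries the standard frame of the face to the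
frame `(e_{succAbove i j})_j`. [folklore] -/
private theorem insertNth_zero_basisVector (i : Fin (m + 1)) (j : Fin m) :
    (i.insertNth (0 : ℝ) (Pi.single j (1 : ℝ) : Fin m → ℝ) : Fin (m + 1) → ℝ) = Pi.single (i.succAbove j) 1 := by
  ext l
  rcases Fin.eq_self_or_eq_succAbove i l with rfl | ⟨k, rfl⟩
  · rw [Fin.insertNth_apply_same, Pi.single_eq_of_ne (Fin.succAbove_ne l j).symm]
  · rw [Fin.insertNth_apply_succAbove, Pi.single_apply, Pi.single_apply]
    simp only [Fin.succAbove_right_inj]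

/-- The front face is the back face translated by `e_i`. [folklore] -/
private theorem insertNth_one_eq_insertNth_zero_add_basisVector (i : Fin (m + 1)) (y : Fin m → ℝ) :
    (i.insertNth (1 : ℝ) y : Fin (m + 1) → ℝ) = i.insertNth 0 y + Pi.single i 1 := by
  ext l
  rcases Fin.eq_self_or_eq_succAbove i l with rfl | ⟨k, rfl⟩
  · simp [Fin.insertNth_apply_same]
  · simp [Fin.insertNth_apply_succAbove, Fin.succAbove_ne]

/-- **A translation-paired face.** If `η(w + e_i) = η(w)` for all `w`, the back-face and front-face integrands of
Stokes' theorem on the unit box agree pointwise. [cite: Spivak1965, Thm. 4-13] -/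
theorem apply_insertNth_zero_eq_apply_insertNth_one_of_periodic
    (η : (Fin (m + 1) → ℝ) → (Fin (m + 1) → ℝ) [⋀^Fin m]→L[ℝ] F') (i : Fin (m + 1))
    (hper : ∀ w, η (w + Pi.single i 1) = η w) (y : Fin m → ℝ) :
    η (i.insertNth 0 y) (fun j ↦ Pi.single (i.succAbove j) 1) =
      η (i.insertNth 1 y) (fun j ↦ Pi.single (i.succAbove j) 1) := by
  rw [insertNth_one_eq_insertNth_zero_add_basisVector, hper]

/-- **A face paired by a unimodular affine map.** Suppose `η = h^*η` for the affine map `h(w) = Lw + d` of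
`ℝ^{m+1}` (`η(w) = η(h w) ∘ L`), that `h` carries the back face `{x_i = 0}` to the front face `{x_i = 1}`
(`h(ι₀ y) = ι₁(G y)` for the face parametrisations `ι_c = insertNth i c`), and that `L` restricts to the face as a
linear map `L_f` of determinant `1` (`L(ι₀ v) = ι₀(L_f v)`). Then the back-face integrand at `y` equals the
front-face integrand at `G y`: `η(ι₀ y)(e_{î}) = η(ι₁(G y))(L e_{î}) = det L_f · η(ι₁(G y))(e_{î})`.
[cite: Spivak1965, Thm. 4-6 and Thm. 4-13] -/
theorem apply_insertNth_zero_eq_apply_insertNth_one_of_invariant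
    (η : (Fin (m + 1) → ℝ) → (Fin (m + 1) → ℝ) [⋀^Fin m]→L[ℝ] F') (i : Fin (m + 1))
    (L : (Fin (m + 1) → ℝ) →L[ℝ] (Fin (m + 1) → ℝ)) (d : Fin (m + 1) → ℝ)
    (hinv : ∀ w, η w = (η (L w + d)).compContinuousLinearMap L)
    (Lf : (Fin m → ℝ) →ₗ[ℝ] (Fin m → ℝ)) (hL : ∀ v, L (i.insertNth 0 v) = i.insertNth 0 (Lf v))
    (hdet : LinearMap.det Lf = 1) (G : (Fin m → ℝ) → (Fin m → ℝ))
    (hG : ∀ y, L (i.insertNth 0 y) + d = i.insertNth 1 (G y)) (y : Fin m → ℝ) :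
    η (i.insertNth 0 y) (fun j ↦ Pi.single (i.succAbove j) 1) =
      η (i.insertNth 1 (G y)) (fun j ↦ Pi.single (i.succAbove j) 1) := by
  rw [hinv (i.insertNth 0 y), ContinuousAlternatingMap.compContinuousLinearMap_apply, hG y]
  set w : Fin (m + 1) → ℝ := i.insertNth (1 : ℝ) (G y) with hw
  -- the linear face embedding `ι₀ : v ↦ insertNth i 0 v`
  let ιi : (Fin m → ℝ) →ₗ[ℝ] (Fin (m + 1) → ℝ) :=
    { toFun := fun v ↦ i.insertNth (0 : ℝ) v
      map_add' := fun v v' ↦ by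
        ext l
        rcases Fin.eq_self_or_eq_succAbove i l with rfl | ⟨k, rfl⟩
        · simp [Fin.insertNth_apply_same]
        · simp [Fin.insertNth_apply_succAbove]
      map_smul' := fun r v ↦ by
        ext l
        rcases Fin.eq_self_or_eq_succAbove i l with rfl | ⟨k, rfl⟩
        · simp [Fin.insertNth_apply_same]
        · simp [Fin.insertNth_apply_succAbove] }
  have hιi : ∀ v, ιi v = i.insertNth 0 v := fun _ ↦ rfl
  set f : (Fin m → ℝ) [⋀^Fin m]→ₗ[ℝ] F' := (η w).toAlternatingMap.compLinearMap ιi with hf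
  have h1 : (⇑L ∘ fun j ↦ (Pi.single (i.succAbove j) (1 : ℝ) : Fin (m + 1) → ℝ)) =
      fun j ↦ ιi (Lf (Pi.basisFun ℝ (Fin m) j)) := by
    funext j
    rw [Function.comp_apply, ← insertNth_zero_basisVector, hL, hιi, Pi.basisFun_apply]
  have h2 : (fun j ↦ (Pi.single (i.succAbove j) (1 : ℝ) : Fin (m + 1) → ℝ)) =
      fun j ↦ ιi (Pi.basisFun ℝ (Fin m) j) := by
    funext j
    rw [hιi, Pi.basisFun_apply, insertNth_zero_basisVector]
  rw [h1, h2]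
  have h3 : ∀ u : Fin m → (Fin m → ℝ), η w (fun j ↦ ιi (u j)) = f u := fun u ↦ by
    rw [hf, AlternatingMap.compLinearMap_apply]
    rfl
  rw [h3 (fun j ↦ Lf (Pi.basisFun ℝ (Fin m) j)), h3]
  have h4 : (fun j ↦ Lf (Pi.basisFun ℝ (Fin m) j)) = ⇑Lf ∘ ⇑(Pi.basisFun ℝ (Fin m)) := rfl
  rw [h4, alternatingMap_apply_linearMap_comp_eq_det_smul (Pi.basisFun ℝ (Fin m)) f Lf, hdet, one_smul]

end Faces

/-! ## §4 `∫_{[0,1]^{m+1}} dη(e₀, …, e_m) = 0` -/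

section Assembly

variable {F' : Type*} [NormedAddCommGroup F'] [NormedSpace ℝ F'] [CompleteSpace F'] {m : ℕ}

/-- **Stokes on the unit box with paired faces: `∫_{[0,1]^{m+1}} dη(e₀, …, e_m) = 0`.** If `η` is `C¹` on a
neighbourhood of the unit box and, for every direction `i`, the back-face integrand is the front-face integrand
composed with a map `G_i` of the face under which the front-face integrand keeps its integral over `[0,1]^m`, then
the `2(m+1)` face terms of Stokes' theorem on the box (`integral_extDeriv_Icc_eq_sum_faces`) cancel in pairs.
[cite: Spivak1965, Thm. 4-13] -/
theorem integral_extDeriv_unitCube_eq_zero (η : (Fin (m + 1) → ℝ) → (Fin (m + 1) → ℝ) [⋀^Fin m]→L[ℝ] F')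
    {U : Set (Fin (m + 1) → ℝ)} (hU : IsOpen U) (hsub : Icc (0 : Fin (m + 1) → ℝ) 1 ⊆ U)
    (hη : ContDiffOn ℝ 1 η U)
    (hface : ∀ i : Fin (m + 1), ∃ G : (Fin m → ℝ) → (Fin m → ℝ),
      (∀ y, η (i.insertNth 0 y) (fun j ↦ Pi.single (i.succAbove j) 1) =
          η (i.insertNth 1 (G y)) (fun j ↦ Pi.single (i.succAbove j) 1)) ∧
        ∫ y in Icc (0 : Fin m → ℝ) 1, η (i.insertNth 1 (G y)) (fun j ↦ Pi.single (i.succAbove j) 1) =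
          ∫ y in Icc (0 : Fin m → ℝ) 1, η (i.insertNth 1 y) (fun j ↦ Pi.single (i.succAbove j) 1)) :
    ∫ x in Icc (0 : Fin (m + 1) → ℝ) 1, extDeriv η x (fun k ↦ Pi.single k 1) = 0 := by
  rw [integral_extDeriv_Icc_eq_sum_faces 0 1 zero_le_one η hU hsub hη]
  refine Finset.sum_eq_zero fun i _ ↦ ?_
  obtain ⟨G, hpt, hint⟩ := hface i
  have hI : Icc ((0 : Fin (m + 1) → ℝ) ∘ i.succAbove) ((1 : Fin (m + 1) → ℝ) ∘ i.succAbove) =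
      Icc (0 : Fin m → ℝ) 1 := rfl
  rw [hI, Pi.one_apply, Pi.zero_apply]
  simp_rw [hpt]
  rw [hint, sub_self, smul_zero]

/-- **Corollary: translation-paired faces only** — for an `η` that is `C¹` near the unit box and periodic under
all unit translations, `η(w + e_i) = η(w)`, the integral of `dη(e₀, …, e_m)` over the box vanishes (the torus
`ℝ^{m+1}/ℤ^{m+1}`). [cite: Spivak1965, Thm. 4-13] -/
theorem integral_extDeriv_unitCube_eq_zero_of_periodic
    (η : (Fin (m + 1) → ℝ) → (Fin (m + 1) → ℝ) [⋀^Fin m]→L[ℝ] F')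
    {U : Set (Fin (m + 1) → ℝ)} (hU : IsOpen U) (hsub : Icc (0 : Fin (m + 1) → ℝ) 1 ⊆ U)
    (hη : ContDiffOn ℝ 1 η U) (hper : ∀ i w, η (w + Pi.single i 1) = η w) :
    ∫ x in Icc (0 : Fin (m + 1) → ℝ) 1, extDeriv η x (fun k ↦ Pi.single k 1) = 0 :=
  integral_extDeriv_unitCube_eq_zero η hU hsub hη fun i ↦
    ⟨id, fun y ↦ apply_insertNth_zero_eq_apply_insertNth_one_of_periodic η i (hper i) y, rfl⟩

end Assembly

end Literature.Analysis.Calculus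

end
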